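import Summits.HodgeConjecture.HodgeConjecture.Theorems.OpenQuestionsFloccariVaresco
import Summits.HodgeConjecture.CorCM.Stage4Interfaces
import Summits.Ventures.HodgeKum4.Statement
import HarnessLib
import HarnessLib.Audit

/-!
# OpenQuestionsFloccariVarescoGlue — kernel links between the typed open questions of Floccari–Varesco 2024 ∕ Floccari–Fu 2026 for `Kumⁿ`-type and the tree's typed rungs (nothing asserted)

HONEST FRAMING: kernel glue only; every theorem below takes the conjectures of
`Theorems/OpenQuestionsFloccariVaresco.lean` (or a named Literature fact) as HYPOTHESES.  Nothing here
asserts `HodgeConjecture`, `HC_AV`, `W₆`, `HC_Kum4Type`, `HC_KummerType` or any conjecture.  Seat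
`hodge-lit-oqh-2` (D-0088(4) LT-H4).  What is linked:
* `HC_KummerTypePowers` ⟹ `Summit.HodgeConjecture.CorCM.Stage4.HC_KummerType` (the power `X¹ ≅ X`, by the
  tree's `hodgeConjectureFor_pow_one_iff`) and ⟹ `Summit.Ventures.HodgeKum4.HC_Kum4TypePowers` (`n = 4`);
* Arapura's named fact `HodgeTheory.Arapura2006_hodgeClasses_algebraic_of_isDominatedByPowers` ∧
  `KummerType_dominatedByFourfoldPowers` ⟹ `HC_KummerType ∧ HC_KummerTypePowers` — the all-`n` form of the
  `Kum⁴` cell's `hc_kum4Type_of_dominated`;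
* the `Kum⁴` cell's conditional chain (`exists_isDominatedByPowers_kum4Type`) proves the `n = 4` instance
  of `KummerType_dominatedByFourfoldPowers` from its own hypotheses L1, L2a′, F_Γ, F_Γ′, L3°, bookkeeping.
-/

noncomputable section

open Literature.AlgebraicGeometry Literature.AlgebraicGeometry.Motives
  Literature.AlgebraicGeometry.HodgeTheory Literature.AlgebraicGeometry.Hyperkaehler

-- `Summit.<Summit>.<Problem>` is the mandated summit-side namespace (CONVENTIONS §2); for the
-- single-conjunct summit `HodgeConjecture` the two coincide, so the duplicate is deliberate.
set_option linter.dupNamespace false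

namespace Summit.HodgeConjecture.HodgeConjecture.Theorems

/-- **KERNEL: the Hodge conjecture for all powers of every projective `Kumⁿ`-variety implies the typed
rung `HC_KummerType`** (the first power `X¹ = Spec ℂ × X ≅ X`, transported by
`hodgeConjectureFor_pow_one_iff`). [cite: FloccariVaresco2024, Rem. 2.2 (§2)] -/
theorem hc_kummerType_of_powers (h : HC_KummerTypePowers) :
    Summit.HodgeConjecture.CorCM.Stage4.HC_KummerType := by
  intro n hn X hX hK
  have h1 : HodgeConjectureFor ((0 + 1) * (2 * n)) (X.pow (0 + 1)) := h n hn hX hK 0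
  rw [zero_add, one_mul] at h1
  exact (hodgeConjectureFor_pow_one_iff X).1 h1

/-- **KERNEL: the `n = 4` instance is the `Kum⁴` cell's bonus statement `HC_Kum4TypePowers`.**
[cite: FloccariVaresco2024, Rem. 2.2 and Rem. 4.4 (§§2, 4)] -/
theorem hc_kum4TypePowers_of_powers (h : HC_KummerTypePowers) :
    Summit.Ventures.HodgeKum4.HC_Kum4TypePowers :=
  fun _ hX hK m ↦ h 4 (by norm_num) hX hK m

/-- **KERNEL (the all-`n` form of `Summit.Ventures.HodgeKum4.hc_kum4Type_of_dominated`): Arapura 2006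
Lemma 4.2 (named fact) and domination of every projective `Kumⁿ`-variety by the powers of a fourfold
whose powers satisfy the Hodge conjecture imply the Hodge conjecture for every projective `Kumⁿ`-variety
AND for all its powers.** [cite: Arapura2006, Lemma 4.2 and Lemma 1.1 (§§1, 4)]
[cite: FloccariFu2026HyperKummer, Conj. 1.4 (PREPRINT; the shape of the hypothesis)] -/
theorem hc_kummerType_of_dominated (hA : Arapura2006_hodgeClasses_algebraic_of_isDominatedByPowers)
    (hD : KummerType_dominatedByFourfoldPowers) :
    Summit.HodgeConjecture.CorCM.Stage4.HC_KummerType ∧ HC_KummerTypePowers := by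
  refine ⟨fun n hn X hX hK ↦ ?_, fun n hn X hX hK m ↦ ?_⟩
  · obtain ⟨B, hB, hHC, hdom⟩ := hD n hn hX hK
    exact (hA hB hX hdom hHC).1
  · obtain ⟨B, hB, hHC, hdom⟩ := hD n hn hX hK
    exact (hA hB hX hdom hHC).2 m

/-- **KERNEL: the `Kum⁴` cell's conditional chain proves the `n = 4` instance of
`KummerType_dominatedByFourfoldPowers`** (from its hypotheses L1, L2a′, F_Γ, F_Γ′, L3° and the
bookkeeping input; by name `Summit.Ventures.HodgeKum4.exists_isDominatedByPowers_kum4Type`).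
[cite: Arapura2006, §1 Lemma 1.1] -/
theorem kummerType_dominatedByFourfoldPowers_four_of_kum4Cell
    (h₁ : Summit.Ventures.HodgeKum4.LefschetzGenerationKum4)
    (h₂ : Summit.Ventures.HodgeKum4.GammaInvariantsDominatedKum4)
    (hΓ : Summit.Ventures.HodgeKum4.Kum4TranslationGroup)
    (hoff : Summit.Ventures.HodgeKum4.Kum4TranslationGroupTrivialOffMiddle)
    (h₃ : Summit.Ventures.HodgeKum4.Kum4NonInvariantClassesAlgebraic)
    (halg : Summit.Ventures.HodgeKum4.AlgebraicClassesDominated) ⦃X : SchemeOver ℂ⦄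
    (hX : IsSmoothProjective (2 * 4) X) (hK : IsOfGeneralizedKummerType 4 X) :
    ∃ B : SchemeOver ℂ, IsSmoothProjective 4 B ∧
      (∀ m : ℕ, HodgeConjectureFor ((m + 1) * 4) (B.pow (m + 1))) ∧ IsDominatedByPowers (2 * 4) X 4 B :=
  Summit.Ventures.HodgeKum4.exists_isDominatedByPowers_kum4Type h₁ h₂ hΓ hoff h₃ halg hX hK

end Summit.HodgeConjecture.HodgeConjecture.Theorems

end
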